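import Summits.BirchSwinnertonDyer.BirchSwinnertonDyer.Theorems.EisensteinPrimesMazurMCOnCellBTwistbackLamOneMazurMC
import Summits.BirchSwinnertonDyer.BirchSwinnertonDyer.Theorems.EisensteinPrimesMultOrderOnePAdicGZ
import HarnessLib

/-!
# Crux 3 `MazurMCOnCellB` (stmt-BirchSwinnertonDyer-19033), line `twistback` v5 — road (d′) PER PAIR WITHOUT Keller–Yin
# Thm. E: Mazur's MC at a non-split X2b pair from STEP L + the two-engine certificate `(μ_an, λ_an) = (0, 1)`, and the
# census cell `(5568g1, 3)`, `_of_padicGZ`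

Width seat bsd-line-x2-p1-w3 (g11), 2026-08-28; sequel of `…EisensteinPrimesMultOrderOnePAdicGZ` (this seat, p660855) over
w5's `…TwistbackLamOneMazurMC`. HONEST FRAMING (cell `bsd-eis`, run/shared/lean/pub/bsd-eis/): conditional theorems only;
named facts BY NAME — the route's `PublishedInputs` (stmt-…-19037), Disegni 2020 Thm. 4(1) (`padicBSD_rankOne_nonsplitMult`,
PUB) and Disegni 2020 Thm. 2.4 (`padicGrossZagier_nonsplitMult`, PUB, p660151); per pair STEP L (`hlow`, which on the
line is fed by Keller–Yin Thm. D — PRE — through stub 3a, NOT through this file), the Heegner datum and the certificate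
`hμ0`/`hlam`. The two theorems are w5's `_of_thmE` theorems of the same names with `hDD` (Dokchitser) + `hKY` (Keller–Yin
Thm. E, PRE) REPLACED by `hDGZ`, the twist's analytic rank being DERIVED by
`…MultOrderOnePAdicGZ.analyticRank_eq_one_of_analyticLambdaEq_one_of_padicGZ` (Perrin-Riou's argument with Disegni's
`p`-adic Gross–Zagier formula). No `def`, no `sorry`; nothing booked: `(5568g1, 3)` stays OPEN (STEP L is an input); no
main conjecture / BSD proved for any curve unconditionally; 0 cells / labels / stubs / tiers move.

* §1 `mazurMainConjectureAt_of_cellB_of_not_split_of_indexLowerBoundAt_of_lamMin_twist_of_padicGZ`.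
* §2 `mazurMainConjectureAt_5568g1_at_three_of_partner23_of_padicGZ` — lam-a g16's display p648214 with the reading
  `hrd` replaced by named facts that are ALL PUBLISHED (the only preprint left at this cell is Thm. D inside `hlow`).

References: [Disegni2020] §2.2 Thm. 2.4, §3.2 Thm. 4; [GreenbergVatsal2000] Thm. (1.3), p. 4; [SteinWuthrich2013] Thm. 6.1;
[Wuthrich2014] Thm. 16; [JetchevSkinnerWan2017] §7.4.1; [PerrinRiou1987] §1.4.
-/

set_option autoImplicit false

-- `Summit.BirchSwinnertonDyer.BirchSwinnertonDyer.…`: the summit and its single sub-problem share a name.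
set_option linter.dupNamespace false

noncomputable section

open scoped Classical MatrixGroups ModularForm

open CongruenceSubgroup WeierstrassCurve NumberField IsDedekindDomain Field
  Literature.NumberTheory.EllipticCurves
  Literature.NumberTheory.GaloisRepresentations
  Literature.NumberTheory.EllipticCurves.ModularForms
  Literature.NumberTheory.EllipticCurves.Rank1Residual
  Literature.NumberTheory.EllipticCurves.Rank1Residual.Typed
  Literature.NumberTheory.EllipticCurves.Disegni2020
  Summit.BirchSwinnertonDyer.Rank1Residual
  Summit.BirchSwinnertonDyer.Rank1Residual.X2
  Summit.BirchSwinnertonDyer.Rank1Residual.X2.RouteGSplitDisplay5568g1Local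
  Summit.BirchSwinnertonDyer.BirchSwinnertonDyer.Theses
  Summit.BirchSwinnertonDyer.BirchSwinnertonDyer.Theorems.EisensteinPrimesMazurMCOnCellBTwistbackOnePartnerCertificates
  Summit.BirchSwinnertonDyer.BirchSwinnertonDyer.Theorems.EisensteinPrimesMazurMCOnCellBTwistbackLamOneRankOne
  Summit.BirchSwinnertonDyer.BirchSwinnertonDyer.Theorems.EisensteinPrimesMazurMCOnCellBTwistbackDisplay5568g1
  Summit.BirchSwinnertonDyer.BirchSwinnertonDyer.Theorems.EisensteinPrimesMazurMCOnCellBTwistbackLamOneMazurMC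
  Summit.BirchSwinnertonDyer.BirchSwinnertonDyer.Theorems.EisensteinPrimesMultOrderOnePAdicGZ

namespace Summit.BirchSwinnertonDyer.BirchSwinnertonDyer.Theorems.EisensteinPrimesMazurMCOnCellBTwistbackLamOneMazurMCPAdicGZ

/-! ## §1. PER PAIR, NON-SPLIT X2b: Mazur's MC from STEP L and `(μ_an, λ_an)(Wd, p) = (0, 1)`, PUBLISHED facts + STEP L -/

/-- **PER PAIR, NON-SPLIT, two-engine form WITHOUT the analytic rank of the partner and WITHOUT Keller–Yin Thm. E**:
w5's `…LamOneMazurMC.mazurMainConjectureAt_of_cellB_of_not_split_of_indexLowerBoundAt_of_lamMin_twist_of_thmE` with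
`hDD` + `hKY` REPLACED by `hDGZ : padicGrossZagier_nonsplitMult` (Disegni 2020 Thm. 2.4, PUB). The twist `Wd` is
multiplicative NON-split at `p` with `E[p]` reducible, of odd analytic rank (`r_an(E) = 0`, Heegner sign); then
`…MultOrderOnePAdicGZ` §3 (`(0,1)` ∧ odd ⟹ `ord_T L_p(Wd) = 1` ⟹ Perrin-Riou + Disegni ⟹ `r_an(Wd) = 1`) supplies `hrd`
for p642512 §5. Inputs by name: `PublishedInputs`, Disegni Thm. 4(1), Disegni Thm. 2.4; per pair STEP L (`hlow`), `hμ0`,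
`hlam`. [cite: Disegni2020, §2.2 Thm. 2.4 and §3.2 Thm. 4] [cite: GreenbergVatsal2000, p. 4 (λ-invariants) and Thm. (1.3)]
[cite: SteinWuthrich2013, Thm. 6.1 (p. 20), §4.2] [cite: Wuthrich2014, Thm. 16 (p. 397)] [cite: JetchevSkinnerWan2017, §7.4.1] -/
theorem mazurMainConjectureAt_of_cellB_of_not_split_of_indexLowerBoundAt_of_lamMin_twist_of_padicGZ
    (hP : EisensteinPrimes.PublishedInputs) (hDis : padicBSD_rankOne_nonsplitMult)
    (hDGZ : padicGrossZagier_nonsplitMult)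
    (W : WeierstrassCurve ℚ) [W.IsElliptic] [W.IsGloballyMinimal] (p : ℕ) [Fact p.Prime]
    (hc : X2.CellB W p) (hns : ¬ W.HasSplitMultiplicativeReductionAtPrime p)
    (N : ℕ) [NeZero N] (K : Type) [Field K] [NumberField K]
    (Dt : ModularParametrizationData W N) (H : HeegnerDatum N (NumberField.discr K)) (ι : K →+* ℂ)
    (P : (W.baseChange K).toAffine.Point)
    (hK : IsImaginaryQuadratic K) (hodd : Odd (NumberField.discr K)) (hlt : NumberField.discr K < -4)
    (hN : W.conductorNorm ℤ = N) (hHN : SatisfiesHeegnerHypothesis N K)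
    (hHp : SatisfiesHeegnerHypothesis p K)
    (hPt : WeierstrassCurve.Affine.Point.map ι.toRatAlgHom P = heegnerPointComplex Dt H)
    (hcM : ¬ (p : ℤ) ∣ Dt.c)
    (Wd : WeierstrassCurve ℚ) [Wd.IsElliptic] [Wd.IsGloballyMinimal]
    (hWd : ∃ C : VariableChange ℚ, C • Wd = W.quadraticTwist (NumberField.discr K : ℚ))
    (hlow : Finite (W.baseChange K).sha → X11b.IndexLowerBoundAt W p K P)
    (hμ0 : X2.AnalyticMuLE Wd p 0) (hlam : X2.AnalyticLambdaEq Wd p 1) :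
    X2.MazurMainConjectureAt W p := by
  have hpar := hP.2.2.2.2.1
  have hnf := hP.2.2.2.2.2.1
  have hHL := hP.2.2.2.2.2.2.1
  have hGZ := hP.2.2.2.2.2.2.2.2.1
  have hWu := hP.2.2.2.2.2.2.2.2.2.2.2.2.2.2.1
  have hp2 : p ≠ 2 := hc.2.1.1
  have hmult : W.HasMultiplicativeReductionAtPrime p := hc.2.1.2.2
  have hr0 : W.analyticRank = 0 := hc.1
  obtain ⟨C, hC⟩ := hWd
  -- the twist is X2, NON-split at `p`
  have hXd : ClassX2 Wd p := X2.classX2_twist W p hc.2.1 K hK hHp Wd ⟨C, hC⟩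
  have hnsd : ¬ Wd.HasSplitMultiplicativeReductionAtPrime p := fun hs ↦
    hns ((X2.hasSplitMultiplicativeReductionAtPrime_iff_of_smul_eq_quadraticTwist W Wd hK p hp2 hmult hHp
      hC).mp hs)
  -- its analytic rank is odd (`r_an(E) = 0`, Heegner sign)
  have hHW : SatisfiesHeegnerHypothesis (W.conductorNorm ℤ) K := by rw [hN]; exact hHN
  have hoddd : Odd Wd.analyticRank := by
    have h := congrArg WeierstrassCurve.analyticRank hC
    rw [analyticRank_smul] at h
    rw [h]
    exact EisensteinPrimesMazurMCOnCellBTwistbackLamOneRankOne.odd_analyticRank_quadraticTwist_of_analyticRank_eq_zero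
      hnf W hr0 K hK hHW
  -- road (d′) core, PUBLISHED inputs: `(0,1)` ∧ odd ⟹ `r_an(Wd) = 1`
  have hrd : Wd.analyticRank = 1 :=
    EisensteinPrimesMultOrderOnePAdicGZ.analyticRank_eq_one_of_analyticLambdaEq_one_of_padicGZ hWu hpar hnf hHL hGZ hDGZ
      Wd p hp2 hXd.2.2 hnsd hXd.2.1 hoddd hμ0 hlam
  exact EisensteinPrimesMazurMCOnCellBTwistbackOnePartnerCertificates.mazurMainConjectureAt_of_cellB_of_not_split_of_indexLowerBoundAt_of_lamMin_twist
    hP hDis W p hc hns N K Dt H ι P hK hodd hlt hN hHN hHp hPt hcM Wd ⟨C, hC⟩ hrd hlow hμ0 hlam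

/-! ## §2. The census cell `(5568g1, 3)`: every named fact on the partner side is PUBLISHED -/

/-- **PER-PAIR DISPLAY, `X2.MazurMainConjectureAt (5568g1) 3`, WITHOUT Keller–Yin Thm. E** — w5's
`…LamOneMazurMC.mazurMainConjectureAt_5568g1_at_three_of_partner23_of_thmE` (over lam-a g16's p648214) with `hDD` + `hKY`
REPLACED by `hDGZ : padicGrossZagier_nonsplitMult` (Disegni 2020 Thm. 2.4, PUB): from, BY NAME, the route's
`PublishedInputs`, Disegni 2020 Thm. 4(1) and Thm. 2.4; PER PAIR the Heegner datum over `K` with `d_K = −23` (`Dt`, `H`, `ι`,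
`P`, `hPt`, `hcM`), STEP L at that datum (`hlow`), and the readings `hr` (`r_an(5568g1) = 0`), `hN` (`N = 5568`) and the
two-engine certificate `hμ0`/`hlam` (`(μ_an, λ_an)(Wd, 3) = (0, 1)` at `Wd = 5568g1 ⊗ χ_{−23}`). Nothing booked;
`(5568g1, 3)` stays OPEN; MC / BSD proved for no curve unconditionally. [cite: Disegni2020, §2.2 Thm. 2.4 and §3.2 Thm. 4]
[cite: GreenbergVatsal2000, Thm. (1.3) with pp. 14–15, p. 4] [cite: SteinWuthrich2013, Thm. 6.1 (p. 20), §4.2]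
[cite: Wuthrich2014, Thm. 16 (p. 397)] [cite: JetchevSkinnerWan2017, §7.4.1] -/
theorem mazurMainConjectureAt_5568g1_at_three_of_partner23_of_padicGZ
    (hP : EisensteinPrimes.PublishedInputs) (hDis : padicBSD_rankOne_nonsplitMult)
    (hDGZ : padicGrossZagier_nonsplitMult)
    (W : WeierstrassCurve ℚ) [W.IsElliptic] [W.IsGloballyMinimal] (hW : W = ⟨0, -1, 0, -493089, 628457121⟩)
    (hr : W.analyticRank = 0)
    (K : Type) [Field K] [NumberField K] (h2 : Module.finrank ℚ K = 2) (hdK : NumberField.discr K = -23)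
    (Dt : ModularParametrizationData W 5568) (H : HeegnerDatum 5568 (NumberField.discr K)) (ι : K →+* ℂ)
    (P : (W.baseChange K).toAffine.Point) (hN : W.conductorNorm ℤ = 5568)
    (hPt : WeierstrassCurve.Affine.Point.map ι.toRatAlgHom P = heegnerPointComplex Dt H)
    (hcM : ¬ ((3 : ℕ) : ℤ) ∣ Dt.c)
    (Wd : WeierstrassCurve ℚ) [Wd.IsElliptic] [Wd.IsGloballyMinimal]
    (hWd : Wd = ⟨0, -1, 0, -260844257, -7644351037599⟩)
    (hlow : Finite (W.baseChange K).sha → X11b.IndexLowerBoundAt W 3 K P)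
    (hμ0 : X2.AnalyticMuLE Wd 3 0) (hlam : X2.AnalyticLambdaEq Wd 3 1) :
    X2.MazurMainConjectureAt W 3 := by
  subst hW hWd
  have hK : IsImaginaryQuadratic K := isImaginaryQuadratic_of_discr_eq_of_neg h2 hdK (by norm_num)
  have hodd : Odd (NumberField.discr K) := by rw [hdK]; exact ⟨-12, by norm_num⟩
  have hlt : NumberField.discr K < -4 := by rw [hdK]; norm_num
  have hWd' : ∃ C : VariableChange ℚ, C • (⟨0, -1, 0, -260844257, -7644351037599⟩ : WeierstrassCurve ℚ) =
      (⟨0, -1, 0, -493089, 628457121⟩ : WeierstrassCurve ℚ).quadraticTwist (NumberField.discr K : ℚ) := by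
    rw [hdK]; exact EisensteinPrimesMazurMCOnCellBTwistbackDisplay5568g1.exists_variableChange_twist23
  exact mazurMainConjectureAt_of_cellB_of_not_split_of_indexLowerBoundAt_of_lamMin_twist_of_padicGZ hP hDis hDGZ _ 3
    (EisensteinPrimesMazurMCOnCellBTwistbackDisplay5568g1.cellB_5568g1_of_analyticRank hr) nonsplit_5568g1.2 5568 K Dt
    H ι P hK hodd hlt hN (EisensteinPrimesMazurMCOnCellBTwistbackDisplay5568g1.satisfiesHeegnerHypothesis_5568 h2 hdK)
    (EisensteinPrimesMazurMCOnCellBTwistbackDisplay5568g1.satisfiesHeegnerHypothesis_3 h2 hdK) hPt hcM _ hWd' hlow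
    hμ0 hlam

end Summit.BirchSwinnertonDyer.BirchSwinnertonDyer.Theorems.EisensteinPrimesMazurMCOnCellBTwistbackLamOneMazurMCPAdicGZ

end
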